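import Summits.QuantumFields.YangMills.Theorems.BalabanUVNodesN15SiteScalarLayerDressed
import HarnessLib

/-!
# Route «BalabanUVNodes», cluster K4 «SpineRates» — node N15 = NE2: THE SITE LAYER WITH THE BACKGROUND LIVE IN THE TwoGrid ENTRY CURRENCY, XI — THE SIZED EDITIONS: the site socket and
# the species bridge of parts IV∕IX with the (3.35) letters read AT SIZE `M` (`c·M·α₀`, smallness `M·α₀ ≤ a₁`), so that SIZE-LIVE families (dag-n15-a programme S ∕ dag-n15-c FILE 40,
# the ones that pass `PairedFamilyGuard.Live`) can carry a U-seeing SITE layer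

Cell `pub-ymgap`, WIDTH SEAT `pub-ymgap-dag-n15-w1` (generation 2; director-ym №197 ∕ HUMAN RULING D-0149; chair R455 (A) ∕ R461; plan g81∕g82 `W-SEAT-START-LIST.md` §n15).  `bears_on:
R4∕N15 · K3⁷ SpineGivenEndpointR13SepCoPH (stmt-QuantumFields-20544)`.  Filed `--kind proof --supports stmt-QuantumFields-20544 --as helper` — COUNT-NEUTRAL.  THEOREMS ONLY (0 `def`,
0 `sorry`).  Imports this seat's part IX `…N15SiteScalarLayerDressed` (parts I–VIII, dag-n15-c S2∕S4 through it) BY NAME; nothing in the tree is modified.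

WHY.  Parts II∕IV's sockets and parts V∕IX's bridges quantify the background smallness as `α₀ ≤ a₁` with letters `ζ·α₀` — right for carriers whose [B9] size field is `1` (`tgGeoC`,
`fgInstanceC2`: part X), too weak for the SIZE-LIVE carriers of dag-n15-a's programme S (`unitTorusGeoS … M_sz`, [B9] Thm 3.1 «for M ≥ M₁»), where the (3.35) letters read `c·M·α₀`
(`reg335_fgInstanceV1GS_iff`) and the printed smallness is `M·α₀ ≤ a₀`.  THIS FILE re-reads both theorems with the smallness parameter `s := M_sz·α₀` (proofs = parts IV∕IX's with `α₀ ↦ s`).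

CONTENTS ([folklore] bookkeeping + landed theorems BY NAME).  §1 ★★ `ne2PlusSite_sSiteExOn_of_sizedLetters` — part IV's socket with `hP`: letters `ζ·((gf i).M·α₀)`, `τ(L^k)^{−γ_P}` under `Reg335 c₃₅ α₀ U`, `(gf i).M·α₀ ≤ a₁` ⟹ `NE2PlusSite`
  (threshold `a₀ = a₁ ∧ γ₀∕(4ζV₁)` ON `M·α₀`, as printed).  §2 ★★★ `siteLetters_of_sizedSpeciesLetters` — part IX's species bridge with species letters `diagK (K·(M_sz i·α₀))`, fit `diagK (K·(M_sz i·α₀)·(L^{k i})^{−γ∕2})` under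
  `M_sz i·α₀ ≤ a₁`, `M_sz i ≥ 1` ⟹ the sized `hP` of §1 for the dressed perturbations `siteEntries (sitePert365 blockOf G′ (dressedOp G′ D V̂))` of THE massless scalar site propagator
  (parts VII∕VIII + dag-n15-c S4 + part V §2, inner rate `δ∕2`, output rate `δ∕4`).  §3 ★★★ `ne2PlusSite_sSiteExOn_of_sizedSpeciesLetters` — §1 ∘ §2 (with `(pair i).M_eq : gf.M = M_sz i`).

HONEST FRAMING.  Count-neutral, species-independent BRIDGE; no new estimate; species a BINDER; the propagator, its dressing and the perturbed matrix `Q′G′²Q′*` are the genuine ∕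
model-exact objects of parts VII–IX (`U ≡ 1` linear theory on the tori of record, King's couplings, `m² = 0`); averaging species `F₂` dropped.  NOT [B9] Thm 3.2 at a general
(3.35)-regular `U` (NE2⁺ NOT PRINTED as an η-rate); Node 00's [B9] layers of record are residual — **N15 is NOT discharged** (typed 28∕28 · discharged 5∕27 of record unchanged); K3⁷ OPEN;
one finite four-torus programme at fixed `ε` — NOT ℝ⁴, NOT infinite volume, NOT OS, NOT a mass gap, NOT Clay; R4 closes the conditional finite-𝕋⁴ rung `BalabanLadder.UV` only.  Restate-immune.
-/

set_option autoImplicit false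

noncomputable section

open scoped BigOperators Matrix
open Finset

namespace Summit.QuantumFields.YangMills.BalabanUVNodes.N15.SiteLayerBg

open Literature.MathematicalPhysics.QuantumFieldTheory.Balaban1983to89
open Literature.MathematicalPhysics.QuantumFieldTheory.Balaban1983to89.B11SectG (BlockNorm HasMaj RowSum)
open Literature.MathematicalPhysics.QuantumFieldTheory.Balaban1983to89.QGQInverse (Coercive)
open Literature.MathematicalPhysics.QuantumFieldTheory.Balaban1983to89.T4EtaRate (PairedInstance EtaPairing NE2PlusSite EtaRateIneqSite)
open Literature.MathematicalPhysics.QuantumFieldTheory.Balaban1983to89.T4EtaRateDefect (idef rateWeight)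
open Literature.MathematicalPhysics.QuantumFieldTheory.Balaban1983to89.T4EtaRateCoeffDefect (pull diagK diagK_nonneg diagK_mono fibre)
open Literature.MathematicalPhysics.QuantumFieldTheory.Balaban1983to89.B5Prop11Plancherel (Tor fine)
open Literature.MathematicalPhysics.QuantumFieldTheory.Balaban1983to89.B4Sect5Torus (tdist tdist_nonneg tdist_symm tdist_triangle tdist_self torusSum_le)
open Literature.MathematicalPhysics.QuantumFieldTheory.Balaban1983to89.B4Sect5Proof (latticeConst latticeConst_nonneg)
open Literature.MathematicalPhysics.QuantumFieldTheory.Balaban1983to89.B5QGGQ145Bounds (Idx kerRe qggqRe)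
open Literature.MathematicalPhysics.QuantumFieldTheory.Balaban1983to89.B5PBridgeProjection (torIdx)
open Literature.MathematicalPhysics.QuantumFieldTheory.Balaban1983to89.B6UnitTorusCarrier (unitTorusGeo triangle254_unitTorusGeo rowSum_unitTorusGeo)
open Literature.MathematicalPhysics.QuantumFieldTheory.Balaban1983to89.B9SectDSup (inv_one_sub_le_two)
open Literature.MathematicalPhysics.QuantumFieldTheory.King1986 (exp_decay_mono aK aK_pos)
open Literature.MathematicalPhysics.QuantumFieldTheory.King1986.Torus (fineOp blockOf tdistT tdistT_nonneg)
open Summit.QuantumFields.YangMills.BalabanUVNodes.N15.VectorPiece (unitTorusGeoS unitTorusGeoS_dist)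
open Summit.QuantumFields.YangMills.BalabanUVNodes.N15.OperatorReadout (opGeo)
open Summit.QuantumFields.YangMills.BalabanUVNodes.N15.TwoGrid (tdistT_eq_tdist_torIdx)
open Summit.QuantumFields.YangMills.BalabanUVNodes.N15.GenuineSite (etaRateIneqSite_opGeo_unit)
open Summit.QuantumFields.YangMills.BalabanUVNodes.N15.BackgroundLayer (blkPair liftPair bgConst bgConst_nonneg)
open Summit.QuantumFields.YangMills.BalabanUVNodes.N15.SiteLayer (dressedOp hasMaj_dressedOp hasMaj_dressedOp_sub hasMaj_idef_dressedOp)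
open Summit.QuantumFields.YangMills.BalabanUVNodes.N15KingModelRung.Curved (kingGOp kingDOp underPtN)

variable {d : ℕ} {L : ℕ} [NeZero L] {I : Type}

/-! ## §1 ★★ The site socket with the perturbation letters read at size `M` -/

section Socket

variable (Mn : I → Fin (d + 1) → ℕ) [hMn0 : ∀ i μ, NeZero (Mn i μ)] (kk mm : I → ℕ) (Msz : I → ℝ) (X : I → Type) [∀ i, Fintype (X i)] (blk : ∀ i, X i → Tor (Mn i))
  (gf : I → B9.Geometry) (Bc Bf : I → B9.Backgrounds)

/-- ★★ **THE SITE SOCKET WITH SIZED LETTERS** — part IV's `ne2PlusSite_sSiteExOn_of_letters` with the perturbations' three letters read AT SIZE: `|Pc i (avg U)|, |Pf i U| ≤ ζ·((gf i).M·α₀)·e^{−δ_P·tdist}`,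
`|Pf i U − Pc i (avg U)| ≤ τ(L^{k i})^{−γ_P}e^{−δ_P·tdist}` under `Reg335 c₃₅ α₀ U` and `(gf i).M·α₀ ≤ a₁` ⟹ `NE2PlusSite d′ p c₃₅ pi (sSiteExOn …)`, the printed smallness `gf.M·α₀ ≤ a₀` USED AS
PRINTED (threshold `a₀ = a₁ ∧ γ₀∕(4ζV₁)` on `M·α₀`).  Part IV's proof verbatim with the smallness parameter `s := gf.M·α₀` (`gf.M ≥ 1`). [cite: Balaban1985BackgroundPropagators, Thm 3.2 (3.48) p.398 + Thm 3.14 pp.426–427 (quantifier template: «for M ≥ M₁», «Mα₀ small»), (3.65)–(3.67) p.403 (mechanism); Balaban1984PropagatorsI, (1.45) p.26; King1986, Prop. 3.8 (3.71) p.664; CombesThomas1973, §II] -/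
theorem ne2PlusSite_sSiteExOn_of_sizedLetters (hLodd : Odd L) (hL2 : 2 ≤ L) {aS : ℝ} (haS : 0 < aS) (c35 : ℝ) (d' : ℕ) (p : ℝ)
    {mT : I → ℕ} (hMnT : ∀ i μ, Mn i μ = 2 * L ^ mT i) (hk : ∀ i, 1 ≤ kk i) (hM : ∀ i, 1 ≤ (gf i).M)
    (pair : ∀ i, EtaPairing (opGeo (unitTorusGeoS L (kk i) (Mn i) (Msz i)) (X i) (blk i)) (gf i) (Bc i) (Bf i))
    (Pf : ∀ i, (Bf i).Cfg → Matrix (Idx (Mn i)) (Idx (Mn i)) ℝ) (Pc : ∀ i, (Bc i).Cfg → Matrix (Idx (Mn i)) (Idx (Mn i)) ℝ) {γP : ℝ} (hγP : 0 < γP)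
    (hP : ∃ δP ζ τ a₁ : ℝ, 0 < δP ∧ 0 < ζ ∧ 0 < τ ∧ 0 < a₁ ∧
      ∀ (i : I) (α₀ : ℝ), 0 < α₀ → (gf i).M * α₀ ≤ a₁ → ∀ U : (Bf i).Cfg, (Bf i).Reg335 c35 α₀ U →
        (∀ p q : Idx (Mn i), |Pc i ((pair i).avg U) p q| ≤ ζ * ((gf i).M * α₀) * Real.exp (-(δP * tdist (Mn i) p q))) ∧
        (∀ p q : Idx (Mn i), |Pf i U p q| ≤ ζ * ((gf i).M * α₀) * Real.exp (-(δP * tdist (Mn i) p q))) ∧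
        (∀ p q : Idx (Mn i), |Pf i U p q - Pc i ((pair i).avg U) p q| ≤ τ * ((L : ℝ) ^ kk i) ^ (-γP) * Real.exp (-(δP * tdist (Mn i) p q)))) :
    NE2PlusSite d' p c35 (fun i => (⟨opGeo (unitTorusGeoS L (kk i) (Mn i) (Msz i)) (X i) (blk i), gf i, Bc i, Bf i, pair i⟩ : PairedInstance))
      (sSiteExOn Mn kk mm Msz X blk gf Bc Bf aS pair Pf Pc) := by
  obtain ⟨γ₀, c₀, δ, Cr, hγ₀, hc₀, hδ, hCr, HF⟩ := siteForm_letters_family (d := d) hLodd hL2 haS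
  obtain ⟨δP, ζ, τ, a₁, hδP, hζ, hτ, ha₁, HP⟩ := hP
  have hL0 : 0 < L := by omega
  have hLr : (1 : ℝ) < L := by exact_mod_cast (show 1 < L by omega)
  have hLR : (1 : ℝ) ≤ L := hLr.le
  -- the common rate, King's torus sums, the Combes–Thomas rate, the threshold (as in part II)
  obtain ⟨κ, hκdef⟩ : ∃ κ : ℝ, κ = min δ δP := ⟨_, rfl⟩
  have hκ : 0 < κ := hκdef ▸ lt_min hδ hδP
  have hκδ : κ ≤ δ := hκdef ▸ min_le_left _ _
  have hκP : κ ≤ δP := hκdef ▸ min_le_right _ _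
  obtain ⟨V₁, hV₁def⟩ : ∃ V₁ : ℝ, V₁ = latticeConst (d + 1) (κ / 4) + 1 := ⟨_, rfl⟩
  have hV₁1 : 1 ≤ V₁ := by rw [hV₁def]; linarith [latticeConst_nonneg (d + 1) (show 0 ≤ κ / 4 by positivity)]
  have hV₁0 : 0 < V₁ := by linarith
  obtain ⟨κ₁, hκ₁def⟩ : ∃ κ₁ : ℝ, κ₁ = min (κ / 4) (γ₀ * κ / (8 * (c₀ + ζ * a₁) * V₁)) := ⟨_, rfl⟩
  have hden : 0 < 8 * (c₀ + ζ * a₁) * V₁ := by positivity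
  have hκ₁ : 0 < κ₁ := hκ₁def ▸ lt_min (by positivity) (div_pos (by positivity) hden)
  have hκ₁κ : κ₁ ≤ κ / 4 := hκ₁def ▸ min_le_left _ _
  have hκ₁s : 8 * (c₀ + ζ * a₁) * V₁ * κ₁ ≤ γ₀ * κ := by
    have h1 : κ₁ ≤ γ₀ * κ / (8 * (c₀ + ζ * a₁) * V₁) := hκ₁def ▸ min_le_right _ _
    have h2 := mul_le_mul_of_nonneg_left h1 hden.le
    rwa [mul_div_cancel₀ _ hden.ne'] at h2
  obtain ⟨V₂, hV₂def⟩ : ∃ V₂ : ℝ, V₂ = latticeConst (d + 1) (κ₁ / 2) + 1 := ⟨_, rfl⟩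
  have hV₂0 : 0 < V₂ := by rw [hV₂def]; linarith [latticeConst_nonneg (d + 1) (show 0 ≤ κ₁ / 2 by positivity)]
  obtain ⟨a₀, ha₀def⟩ : ∃ a₀ : ℝ, a₀ = min a₁ (γ₀ / (4 * ζ * V₁)) := ⟨_, rfl⟩
  have ha₀ : 0 < a₀ := ha₀def ▸ lt_min ha₁ (div_pos hγ₀ (by positivity))
  obtain ⟨γo, hγodef⟩ : ∃ γo : ℝ, γo = min (1 / 4) γP := ⟨_, rfl⟩
  have hγo : 0 < γo := hγodef ▸ lt_min (by norm_num) hγP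
  have hγo4 : γo ≤ 1 / 4 := hγodef ▸ min_le_left _ _
  have hγoP : γo ≤ γP := hγodef ▸ min_le_right _ _
  refine ⟨1, κ₁ / 2, a₀, 4 / γ₀ * (Cr + τ) * (4 / γ₀) * V₂ ^ 2, γo, one_pos, half_pos hκ₁, ha₀, by positivity, hγo, fun i _ α₀ hα₀ hMα U hreg => ?_⟩
  -- this index: the smallness parameter is `s := M·α₀`
  set s : ℝ := (gf i).M * α₀ with hsdef
  have hs0 : 0 < s := mul_pos (lt_of_lt_of_le one_pos (hM i)) hα₀
  have hαa₀ : s ≤ a₀ := hMα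
  have hαa₁ : s ≤ a₁ := hαa₀.trans (ha₀def ▸ min_le_left _ _)
  have hM1 : ∀ μ, 1 ≤ Mn i μ := fun μ => Nat.one_le_iff_ne_zero.mpr (NeZero.ne _)
  obtain ⟨hcoK, hcoK', hK, hK', hKK⟩ := HF (mT i) (kk i) (mm i) (hk i) (Mn i) (hMnT i)
  obtain ⟨hPc, hPf, hPfc⟩ := HP i α₀ hα₀ hαa₁ U hreg
  have hρ : ∀ p q : Idx (Mn i), 0 ≤ tdist (Mn i) p q := tdist_nonneg _
  have hρs : ∀ p q : Idx (Mn i), tdist (Mn i) p q = tdist (Mn i) q p := tdist_symm hM1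
  have hρ0 : ∀ p : Idx (Mn i), tdist (Mn i) p p = 0 := tdist_self _
  have hρt : ∀ p q r : Idx (Mn i), tdist (Mn i) p r ≤ tdist (Mn i) p q + tdist (Mn i) q r := tdist_triangle hM1
  have hV₁ : ∀ p : Idx (Mn i), ∑ q, Real.exp (-(κ / 4 * tdist (Mn i) p q)) ≤ V₁ := fun p =>
    (torusSum_le (d + 1) hM1 (by positivity) p).trans (by rw [hV₁def]; linarith)
  have hV₂ : ∀ p : Idx (Mn i), ∑ q, Real.exp (-(κ₁ / 2 * tdist (Mn i) p q)) ≤ V₂ := fun p =>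
    (torusSum_le (d + 1) hM1 (by positivity) p).trans (by rw [hV₂def]; linarith)
  have hLk1 : (1 : ℝ) ≤ (L : ℝ) ^ kk i := one_le_pow₀ hLR
  have hr4 : ((L : ℝ) ^ kk i) ^ (-(1 / 4 : ℝ)) ≤ ((L : ℝ) ^ kk i) ^ (-γo) := Real.rpow_le_rpow_of_exponent_le hLk1 (by linarith)
  have hrP : ((L : ℝ) ^ kk i) ^ (-γP) ≤ ((L : ℝ) ^ kk i) ^ (-γo) := Real.rpow_le_rpow_of_exponent_le hLk1 (by linarith)
  have hro : 0 ≤ ((L : ℝ) ^ kk i) ^ (-γo) := Real.rpow_nonneg (by positivity) _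
  have hK₁ : ∀ p q, |qggqRe (L ^ kk i) (aK aS L (kk i)) (Mn i) p q| ≤ c₀ * Real.exp (-(κ * tdist (Mn i) p q)) :=
    fun p q => (hK p q).trans (exp_decay_mono hc₀.le hκδ (hρ p q))
  have hK₁' : ∀ p q, |qggqRe (L ^ mm i * L ^ kk i) (aK aS L (kk i + mm i)) (Mn i) p q| ≤ c₀ * Real.exp (-(κ * tdist (Mn i) p q)) :=
    fun p q => (hK' p q).trans (exp_decay_mono hc₀.le hκδ (hρ p q))
  have hKK₁ : ∀ p q, |qggqRe (L ^ mm i * L ^ kk i) (aK aS L (kk i + mm i)) (Mn i) p q - qggqRe (L ^ kk i) (aK aS L (kk i)) (Mn i) p q|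
      ≤ Cr * ((L : ℝ) ^ kk i) ^ (-γo) * Real.exp (-(κ * tdist (Mn i) p q)) := fun p q =>
    (hKK p q).trans ((mul_le_mul_of_nonneg_right (mul_le_mul_of_nonneg_left hr4 hCr.le) (Real.exp_nonneg _)).trans
      (exp_decay_mono (mul_nonneg hCr.le hro) hκδ (hρ p q)))
  have hPc₁ : ∀ p q, |Pc i ((pair i).avg U) p q| ≤ ζ * s * Real.exp (-(κ * tdist (Mn i) p q)) :=
    fun p q => (hPc p q).trans (exp_decay_mono (by positivity) hκP (hρ p q))
  have hPf₁ : ∀ p q, |Pf i U p q| ≤ ζ * s * Real.exp (-(κ * tdist (Mn i) p q)) :=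
    fun p q => (hPf p q).trans (exp_decay_mono (by positivity) hκP (hρ p q))
  have hPP₁ : ∀ p q, |Pf i U p q - Pc i ((pair i).avg U) p q| ≤ τ * ((L : ℝ) ^ kk i) ^ (-γo) * Real.exp (-(κ * tdist (Mn i) p q)) := fun p q =>
    (hPfc p q).trans ((mul_le_mul_of_nonneg_right (mul_le_mul_of_nonneg_left hrP hτ.le) (Real.exp_nonneg _)).trans
      (exp_decay_mono (mul_nonneg hτ.le hro) hκP (hρ p q)))
  have hs₁ : ζ * s * V₁ ≤ γ₀ / 2 := by
    have h1 : s ≤ γ₀ / (4 * ζ * V₁) := hαa₀.trans (ha₀def ▸ min_le_right _ _)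
    have h2 := mul_le_mul_of_nonneg_left h1 (show 0 ≤ 4 * ζ * V₁ by positivity)
    rw [mul_div_cancel₀ _ (by positivity : (4 * ζ * V₁ : ℝ) ≠ 0)] at h2
    nlinarith
  have hs₂ : 8 * (c₀ + ζ * s) * V₁ * κ₁ ≤ γ₀ * κ := by
    have h1 : 8 * (c₀ + ζ * s) * V₁ * κ₁ ≤ 8 * (c₀ + ζ * a₁) * V₁ * κ₁ := by
      have := mul_le_mul_of_nonneg_left hαa₁ hζ.le
      have hVκ : 0 ≤ V₁ * κ₁ := by positivity
      nlinarith
    exact h1.trans hκ₁s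
  have h := abs_inv_add_sub_inv_add_le_of_coercive (tdist (Mn i)) hρ hρs hρ0 hρt hγ₀ hc₀.le (by positivity : 0 ≤ ζ * s)
    (by positivity : 0 ≤ Cr * ((L : ℝ) ^ kk i) ^ (-γo)) (by positivity : 0 ≤ τ * ((L : ℝ) ^ kk i) ^ (-γo)) hκ hκ₁.le hκ₁κ hcoK hcoK' hK₁ hK₁' hPc₁ hPf₁ hKK₁ hPP₁
    hV₁ hV₂ hs₁ hs₂
  -- the unit-site readout (G1) over the general carrier: `len ≡ 1`, rate factor `(L^k)^{−γo}`
  have hLne : (L : ℝ) ≠ 0 := by exact_mod_cast (NeZero.ne L)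
  have hLpos : (0 : ℝ) < (L : ℝ) := by exact_mod_cast hL0
  have hlen : ∀ y : (unitTorusGeoS L (kk i) (Mn i) (Msz i)).Site, (unitTorusGeoS L (kk i) (Mn i) (Msz i)).len y = 1 := fun y => by
    show (L : ℝ) ^ kk i * ((L : ℝ) ^ kk i)⁻¹ = 1
    exact mul_inv_cancel₀ (pow_ne_zero _ hLne)
  have hη : (unitTorusGeoS L (kk i) (Mn i) (Msz i)).eta ≠ 0 := inv_ne_zero (pow_ne_zero _ hLpos.ne')
  refine etaRateIneqSite_opGeo_unit (g := unitTorusGeoS L (kk i) (Mn i) (Msz i)) (B := Bf i) (sSiteExOn Mn kk mm Msz X blk gf Bc Bf aS pair Pf Pc i)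
    hlen hη hLpos (fun y y' => ?_) d' p
  have hyy := h (torIdx (Mn i) y) (torIdx (Mn i) y')
  rw [← tdistT_eq_tdist_torIdx] at hyy
  show |siteEx (L ^ mm i * L ^ kk i) (aK aS L (kk i + mm i)) (Mn i) (Pf i U) (torIdx (Mn i) y) (torIdx (Mn i) y')
        - siteEx (L ^ kk i) (aK aS L (kk i)) (Mn i) (Pc i ((pair i).avg U)) (torIdx (Mn i) y) (torIdx (Mn i) y')|
      ≤ 4 / γ₀ * (Cr + τ) * (4 / γ₀) * V₂ ^ 2 * Real.exp (-(κ₁ / 2 * tdistT (Mn i) y y')) * max (((L : ℝ) ^ kk i) ^ (-γo)) (((L : ℝ) ^ kk i) ^ (-γo))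
  rw [max_self]
  unfold siteEx
  refine hyy.trans (le_of_eq ?_)
  ring

end Socket

/-! ## §2 ★★★ The sockets' sized letters from a species' three diagonal letters read at size -/

section Letters

variable (Mn : I → Fin (d + 1) → ℕ) [hMn0 : ∀ i μ, NeZero (Mn i μ)] (kk mm : I → ℕ) (Msz : I → ℝ) (Bc Bf : I → B9.Backgrounds)
  (avg : ∀ i, (Bf i).Cfg → (Bc i).Cfg)
  (Vc : ∀ i, (Bc i).Cfg → ((Tor (fine (L ^ kk i) (Mn i)) × Option (Fin (d + 1)) → ℝ) →ₗ[ℝ] (Tor (fine (L ^ kk i) (Mn i)) → ℝ)))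
  (Vf : ∀ i, (Bf i).Cfg → ((Tor (fine (L ^ mm i * L ^ kk i) (Mn i)) × Option (Fin (d + 1)) → ℝ) →ₗ[ℝ] (Tor (fine (L ^ mm i * L ^ kk i) (Mn i)) → ℝ)))
set_option maxHeartbeats 400000 in
/-- ★★★ **THE SIZED SITE LETTERS FROM A SCALAR-SITE SPECIES' THREE DIAGONAL LETTERS READ AT SIZE** — part IX's `siteLetters_of_speciesLetters` with the smallness parameter
`s = M_sz i·α₀`: HYPOTHESIS `hV` = constants `K ≥ 0`, `a₁ > 0` with, for `α₀ > 0`, `M_sz i·α₀ ≤ a₁`, `U` `(3.35)`-regular at level `c₃₅`: `V̂c i (avg U) ≤ diagK (K s)`, `V̂f i U ≤ diagK (K s)`,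
`𝔇(V̂f i U, V̂c i (avg U)) ≤ diagK (K s (L^{k i})^{−γ∕2})`; CONCLUSION = §1's sized `hP` for `Pf∕Pc := siteEntries (sitePert365 … G′ (dressedOp G′ D V̂))`, `G′` THE massless scalar site propagator
of the run (parts VII∕VIII), rate exponent `γ∕2`; odd `L ≥ 3`, `a_S > 0`, `0 < γ < 1`, `k i, m i ≥ 1`, `M_sz i ≥ 1`. [cite: Balaban1985BackgroundPropagators, (3.63)–(3.67) pp.402–403 (mechanism), (3.35) p.396 («|A| < O(1)Mα₀ …»: the letters at size); King1986, Prop. 3.8 (3.71) p.664] -/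
theorem siteLetters_of_sizedSpeciesLetters (hLodd : Odd L) (hL2 : 2 ≤ L) {aS : ℝ} (haS : 0 < aS) (c35 : ℝ) {γ : ℝ} (hγ0 : 0 < γ) (hγ1 : γ < 1)
    {mT : I → ℕ} (hMnT : ∀ i μ, Mn i μ = 2 * L ^ mT i) (hk : ∀ i, 1 ≤ kk i) (hm : ∀ i, 1 ≤ mm i)
    (hMsz : ∀ i, 1 ≤ Msz i)
    (hV : ∃ K a₁ : ℝ, 0 ≤ K ∧ 0 < a₁ ∧ ∀ (i : I) (α₀ : ℝ), 0 < α₀ → Msz i * α₀ ≤ a₁ → ∀ U : (Bf i).Cfg, (Bf i).Reg335 c35 α₀ U →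
      HasMaj (BlockNorm.ofBlocks (unitTorusGeoS L (kk i) (Mn i) (Msz i)) (blkPair (blockOf (L ^ kk i) (Mn i))))
        (BlockNorm.ofBlocks (unitTorusGeoS L (kk i) (Mn i) (Msz i)) (blockOf (L ^ kk i) (Mn i))) (Vc i (avg i U)) (diagK fun _ => K * (Msz i * α₀)) ∧
      HasMaj (BlockNorm.ofBlocks (unitTorusGeoS L (kk i) (Mn i) (Msz i)) (blkPair (blockOf (L ^ kk i) (Mn i) ∘ underPtN L (kk i) (mm i) (Mn i))))
        (BlockNorm.ofBlocks (unitTorusGeoS L (kk i) (Mn i) (Msz i)) (blockOf (L ^ kk i) (Mn i) ∘ underPtN L (kk i) (mm i) (Mn i))) (Vf i U) (diagK fun _ => K * (Msz i * α₀)) ∧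
      HasMaj (BlockNorm.ofBlocks (unitTorusGeoS L (kk i) (Mn i) (Msz i)) (blkPair (blockOf (L ^ kk i) (Mn i))))
        (BlockNorm.ofBlocks (unitTorusGeoS L (kk i) (Mn i) (Msz i)) (blockOf (L ^ kk i) (Mn i) ∘ underPtN L (kk i) (mm i) (Mn i)))
        (idef (pull (liftPair (underPtN L (kk i) (mm i) (Mn i)))) (pull (underPtN L (kk i) (mm i) (Mn i))) (Vf i U) (Vc i (avg i U)))
        (diagK fun _ => K * (Msz i * α₀) * ((L : ℝ) ^ kk i) ^ (-(γ / 2)))) :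
    ∃ δP ζ τ a₁ : ℝ, 0 < δP ∧ 0 < ζ ∧ 0 < τ ∧ 0 < a₁ ∧
      ∀ (i : I) (α₀ : ℝ), 0 < α₀ → Msz i * α₀ ≤ a₁ → ∀ U : (Bf i).Cfg, (Bf i).Reg335 c35 α₀ U →
        (∀ p p' : Idx (Mn i), |siteEntries (Mn i) (sitePert365 (Mn i) (blockOf (L ^ kk i) (Mn i)) (kingGOp L aS 0 (kk i) (L ^ kk i) (Mn i))
            (dressedOp (kingGOp L aS 0 (kk i) (L ^ kk i) (Mn i)) (fun μ => kingDOp L aS 0 (kk i) (L ^ kk i) (Mn i) μ) (Vc i (avg i U)))) p p'|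
            ≤ ζ * (Msz i * α₀) * Real.exp (-(δP * tdist (Mn i) p p'))) ∧
        (∀ p p' : Idx (Mn i), |siteEntries (Mn i) (sitePert365 (Mn i) (blockOf (L ^ kk i) (Mn i) ∘ underPtN L (kk i) (mm i) (Mn i))
            (kingGOp L aS 0 (kk i + mm i) (L ^ mm i * L ^ kk i) (Mn i))
            (dressedOp (kingGOp L aS 0 (kk i + mm i) (L ^ mm i * L ^ kk i) (Mn i)) (fun μ => kingDOp L aS 0 (kk i + mm i) (L ^ mm i * L ^ kk i) (Mn i) μ) (Vf i U))) p p'|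
            ≤ ζ * (Msz i * α₀) * Real.exp (-(δP * tdist (Mn i) p p'))) ∧
        (∀ p p' : Idx (Mn i), |siteEntries (Mn i) (sitePert365 (Mn i) (blockOf (L ^ kk i) (Mn i) ∘ underPtN L (kk i) (mm i) (Mn i))
              (kingGOp L aS 0 (kk i + mm i) (L ^ mm i * L ^ kk i) (Mn i))
              (dressedOp (kingGOp L aS 0 (kk i + mm i) (L ^ mm i * L ^ kk i) (Mn i)) (fun μ => kingDOp L aS 0 (kk i + mm i) (L ^ mm i * L ^ kk i) (Mn i) μ) (Vf i U))) p p'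
            - siteEntries (Mn i) (sitePert365 (Mn i) (blockOf (L ^ kk i) (Mn i)) (kingGOp L aS 0 (kk i) (L ^ kk i) (Mn i))
              (dressedOp (kingGOp L aS 0 (kk i) (L ^ kk i) (Mn i)) (fun μ => kingDOp L aS 0 (kk i) (L ^ kk i) (Mn i) μ) (Vc i (avg i U)))) p p'|
            ≤ τ * ((L : ℝ) ^ kk i) ^ (-(γ / 2)) * Real.exp (-(δP * tdist (Mn i) p p'))) := by
  obtain ⟨β, δ, m₀, hβ, hδ, hm₀, HU⟩ := kingScalarLayer_massless_letters (d := d) L hLodd hL2 haS hγ0.le hγ1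
  obtain ⟨K, a₁, hK, ha₁, HV⟩ := hV
  have hLr : (0 : ℝ) ≤ (L : ℝ) := Nat.cast_nonneg _
  -- the Combes–Thomas row sum at `σ = δ∕2`, the threshold on `s = M_sz·α₀`
  set cr : ℝ := latticeConst (d + 1) (δ / 2) with hcr_def
  have hcr : 0 ≤ cr := latticeConst_nonneg _ (by positivity)
  set a₁' : ℝ := min a₁ (1 / (2 * β * K * cr + 1)) with ha₁'_def
  have hden : 0 < 2 * β * K * cr + 1 := by positivity
  have ha₁' : 0 < a₁' := lt_min ha₁ (by positivity)
  have ha₁'a₁ : a₁' ≤ a₁ := min_le_left _ _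
  have hguard : β * (K * a₁') * cr ≤ 1 / 2 := by
    have h1 : a₁' ≤ 1 / (2 * β * K * cr + 1) := min_le_right _ _
    have h2 : β * K * cr * a₁' ≤ β * K * cr * (1 / (2 * β * K * cr + 1)) := mul_le_mul_of_nonneg_left h1 (by positivity)
    have h3 : β * K * cr * (1 / (2 * β * K * cr + 1)) ≤ 1 / 2 := by
      rw [mul_one_div, div_le_iff₀ hden]; nlinarith [mul_nonneg (mul_nonneg hβ.le hK) hcr]
    nlinarith
  -- the output constants (part V's `(δ∕2, (B+β)εc + 1, 2c(Bm + βm₀) + 1)` at `B = 2β`, `ε = 2β²Kc_r + 1`, `m = bgConst(…, a₁′)`, inner rate `δ∕2`)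
  obtain ⟨B, hBdef⟩ : ∃ B : ℝ, B = 2 * β := ⟨_, rfl⟩
  obtain ⟨ε, hεdef⟩ : ∃ ε : ℝ, ε = 2 * β ^ 2 * K * cr + 1 := ⟨_, rfl⟩
  obtain ⟨mX, hmXdef⟩ : ∃ mX : ℝ, mX = bgConst β cr m₀ K a₁' := ⟨_, rfl⟩
  have hB0 : 0 ≤ B := by rw [hBdef]; positivity
  have hε0 : 0 < ε := by rw [hεdef]; positivity
  have hmX0 : 0 ≤ mX := by rw [hmXdef]; exact bgConst_nonneg hβ.le hcr hm₀.le hK ha₁'.le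
  obtain ⟨c2, hc2def⟩ : ∃ c2 : ℝ, c2 = latticeConst (d + 1) (δ / 2 / 2) := ⟨_, rfl⟩
  have hc2 : 0 ≤ c2 := by rw [hc2def]; exact latticeConst_nonneg _ (by positivity)
  refine ⟨δ / 2 / 2, (B + β) * ε * c2 + 1, 2 * c2 * (B * mX + β * m₀) + 1, a₁', by positivity, by positivity, by positivity, ha₁', fun i α₀ hα₀ hsa U hreg => ?_⟩
  obtain ⟨hG, hD, hG', hD', hDG, hDD⟩ := HU (kk i) (hk i) (mm i) (hm i) (mT i) (Mn i) (hMnT i) (Msz i)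
  -- the smallness parameter of the index `s = M_sz i·α₀` (kept syntactic)
  have hs0 : 0 < Msz i * α₀ := mul_pos (lt_of_lt_of_le one_pos (hMsz i)) hα₀
  have hsa₁ : Msz i * α₀ ≤ a₁ := hsa.trans ha₁'a₁
  -- carrier facts
  have htri := triangle254_unitTorusGeo L (kk i) (Mn i)
  have hrow := rowSum_unitTorusGeo L (kk i) (Mn i) (half_pos hδ)
  have hd : ∀ a b : (unitTorusGeoS L (kk i) (Mn i) (Msz i)).Site, 0 ≤ (unitTorusGeoS L (kk i) (Mn i) (Msz i)).dist a b := fun a b => tdistT_nonneg (Mn i) a b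
  have hθ : 0 ≤ ((L : ℝ) ^ kk i) ^ (-(γ / 2)) := Real.rpow_nonneg (pow_nonneg hLr _) _
  obtain ⟨N, hN, hfibi⟩ := card_fibre_underPtN_ne (L := L) (kk i) (mm i) (Mn i)
  -- the species letters at `R = K·s`
  obtain ⟨hVc, hVf, hDV⟩ := HV i α₀ hα₀ hsa₁ U hreg
  have hR : 0 ≤ K * (Msz i * α₀) := mul_nonneg hK hs0.le
  have hq : β * (K * (Msz i * α₀)) * cr ≤ 1 / 2 := (mul_le_mul_of_nonneg_right (mul_le_mul_of_nonneg_left (mul_le_mul_of_nonneg_left hsa hK) hβ.le) hcr).trans hguard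
  have hq1 : β * (K * (Msz i * α₀)) * cr < 1 := by linarith
  have hinv : (1 - β * (K * (Msz i * α₀)) * cr)⁻¹ ≤ 2 := inv_one_sub_le_two hq
  have hinv0 : 0 ≤ (1 - β * (K * (Msz i * α₀)) * cr)⁻¹ := inv_nonneg.2 (by linarith)
  have hρδ : δ / 2 + δ / 2 ≤ δ := by linarith
  -- S4's three dressing theorems, coarse and fine
  have hXc := hasMaj_dressedOp (g := unitTorusGeoS L (kk i) (Mn i) (Msz i)) (blockOf (L ^ kk i) (Mn i)) htri hd hrow (by positivity) (by positivity : (0 : ℝ) ≤ δ / 2) hρδ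
    hβ.le hR hG hD hVc hq1
  have hXf := hasMaj_dressedOp (g := unitTorusGeoS L (kk i) (Mn i) (Msz i)) (blockOf (L ^ kk i) (Mn i) ∘ underPtN L (kk i) (mm i) (Mn i)) htri hd hrow (by positivity)
    (by positivity : (0 : ℝ) ≤ δ / 2) hρδ hβ.le hR hG' hD' hVf hq1
  have hEc := hasMaj_dressedOp_sub (g := unitTorusGeoS L (kk i) (Mn i) (Msz i)) (blockOf (L ^ kk i) (Mn i)) htri hd hrow (by positivity) (by positivity : (0 : ℝ) ≤ δ / 2) hρδ
    hβ.le hR hG hD hVc hq1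
  have hEf := hasMaj_dressedOp_sub (g := unitTorusGeoS L (kk i) (Mn i) (Msz i)) (blockOf (L ^ kk i) (Mn i) ∘ underPtN L (kk i) (mm i) (Mn i)) htri hd hrow (by positivity)
    (by positivity : (0 : ℝ) ≤ δ / 2) hρδ hβ.le hR hG' hD' hVf hq1
  have hDX := hasMaj_idef_dressedOp (g := unitTorusGeoS L (kk i) (Mn i) (Msz i)) (blockOf (L ^ kk i) (Mn i)) (underPtN L (kk i) (mm i) (Mn i)) htri hd hrow (by positivity) hcr
    (K := K) (a₀ := Msz i * α₀) (by linarith : δ / 2 ≤ δ) hβ.le hm₀.le hθ hq hR le_rfl hG hD hG' hD' hDG hDD hVc hVf hDV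
  -- the dressed letters at rate `δ∕2` with the announced constants
  have wk : ∀ {C : ℝ}, 0 ≤ C → ∀ y y' : Tor (Mn i), C * Real.exp (-(δ * tdistT (Mn i) y y')) ≤ C * Real.exp (-(δ / 2 * (unitTorusGeoS L (kk i) (Mn i) (Msz i)).dist y y')) :=
    fun hC y y' => mul_le_mul_of_nonneg_left (Real.exp_le_exp.mpr (neg_le_neg (by
      rw [unitTorusGeoS_dist]; nlinarith [tdistT_nonneg (Mn i) y y', hδ]))) hC
  have hGc2 := hG.mono (wk hβ.le)
  have hGf2 := hG'.mono (wk hβ.le)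
  have hDG2 : HasMaj (BlockNorm.ofBlocks (unitTorusGeoS L (kk i) (Mn i) (Msz i)) (blockOf (L ^ kk i) (Mn i)))
      (BlockNorm.ofBlocks (unitTorusGeoS L (kk i) (Mn i) (Msz i)) (blockOf (L ^ kk i) (Mn i) ∘ underPtN L (kk i) (mm i) (Mn i)))
      (idef (pull (underPtN L (kk i) (mm i) (Mn i))) (pull (underPtN L (kk i) (mm i) (Mn i)))
        (kingGOp L aS 0 (kk i + mm i) (L ^ mm i * L ^ kk i) (Mn i)) (kingGOp L aS 0 (kk i) (L ^ kk i) (Mn i)))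
      (fun y y' => m₀ * ((L : ℝ) ^ kk i) ^ (-(γ / 2)) * Real.exp (-(δ / 2 * (unitTorusGeoS L (kk i) (Mn i) (Msz i)).dist y y'))) := hDG.mono (wk (mul_nonneg hm₀.le hθ))
  have hXc2 : HasMaj (BlockNorm.ofBlocks (unitTorusGeoS L (kk i) (Mn i) (Msz i)) (blockOf (L ^ kk i) (Mn i))) (BlockNorm.ofBlocks (unitTorusGeoS L (kk i) (Mn i) (Msz i)) (blockOf (L ^ kk i) (Mn i)))
      (dressedOp (kingGOp L aS 0 (kk i) (L ^ kk i) (Mn i)) (fun μ => kingDOp L aS 0 (kk i) (L ^ kk i) (Mn i) μ) (Vc i (avg i U)))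
      (fun y y' => B * Real.exp (-(δ / 2 * (unitTorusGeoS L (kk i) (Mn i) (Msz i)).dist y y'))) :=
    hXc.mono fun y y' => mul_le_mul_of_nonneg_right (by nlinarith [mul_le_mul_of_nonneg_left hinv hβ.le]) (Real.exp_nonneg _)
  have hXf2 : HasMaj (BlockNorm.ofBlocks (unitTorusGeoS L (kk i) (Mn i) (Msz i)) (blockOf (L ^ kk i) (Mn i) ∘ underPtN L (kk i) (mm i) (Mn i)))
      (BlockNorm.ofBlocks (unitTorusGeoS L (kk i) (Mn i) (Msz i)) (blockOf (L ^ kk i) (Mn i) ∘ underPtN L (kk i) (mm i) (Mn i)))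
      (dressedOp (kingGOp L aS 0 (kk i + mm i) (L ^ mm i * L ^ kk i) (Mn i)) (fun μ => kingDOp L aS 0 (kk i + mm i) (L ^ mm i * L ^ kk i) (Mn i) μ) (Vf i U))
      (fun y y' => B * Real.exp (-(δ / 2 * (unitTorusGeoS L (kk i) (Mn i) (Msz i)).dist y y'))) :=
    hXf.mono fun y y' => mul_le_mul_of_nonneg_right (by nlinarith [mul_le_mul_of_nonneg_left hinv hβ.le]) (Real.exp_nonneg _)
  have hamp : β * (K * (Msz i * α₀) * (β * (1 - β * (K * (Msz i * α₀)) * cr)⁻¹)) * cr ≤ ε * (Msz i * α₀) := by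
    have h1 : β * (K * (Msz i * α₀) * (β * (1 - β * (K * (Msz i * α₀)) * cr)⁻¹)) * cr = (β * β * K * cr * (1 - β * (K * (Msz i * α₀)) * cr)⁻¹) * (Msz i * α₀) := by ring
    rw [h1]
    refine mul_le_mul_of_nonneg_right ?_ hs0.le
    rw [hεdef]
    nlinarith [mul_le_mul_of_nonneg_left hinv (show 0 ≤ β * β * K * cr by positivity)]
  have hEc2 : HasMaj (BlockNorm.ofBlocks (unitTorusGeoS L (kk i) (Mn i) (Msz i)) (blockOf (L ^ kk i) (Mn i))) (BlockNorm.ofBlocks (unitTorusGeoS L (kk i) (Mn i) (Msz i)) (blockOf (L ^ kk i) (Mn i)))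
      (dressedOp (kingGOp L aS 0 (kk i) (L ^ kk i) (Mn i)) (fun μ => kingDOp L aS 0 (kk i) (L ^ kk i) (Mn i) μ) (Vc i (avg i U)) - kingGOp L aS 0 (kk i) (L ^ kk i) (Mn i))
      (fun y y' => ε * (Msz i * α₀) * Real.exp (-(δ / 2 * (unitTorusGeoS L (kk i) (Mn i) (Msz i)).dist y y'))) :=
    hEc.mono fun y y' => mul_le_mul_of_nonneg_right hamp (Real.exp_nonneg _)
  have hEf2 : HasMaj (BlockNorm.ofBlocks (unitTorusGeoS L (kk i) (Mn i) (Msz i)) (blockOf (L ^ kk i) (Mn i) ∘ underPtN L (kk i) (mm i) (Mn i)))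
      (BlockNorm.ofBlocks (unitTorusGeoS L (kk i) (Mn i) (Msz i)) (blockOf (L ^ kk i) (Mn i) ∘ underPtN L (kk i) (mm i) (Mn i)))
      (dressedOp (kingGOp L aS 0 (kk i + mm i) (L ^ mm i * L ^ kk i) (Mn i)) (fun μ => kingDOp L aS 0 (kk i + mm i) (L ^ mm i * L ^ kk i) (Mn i) μ) (Vf i U)
        - kingGOp L aS 0 (kk i + mm i) (L ^ mm i * L ^ kk i) (Mn i))
      (fun y y' => ε * (Msz i * α₀) * Real.exp (-(δ / 2 * (unitTorusGeoS L (kk i) (Mn i) (Msz i)).dist y y'))) :=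
    hEf.mono fun y y' => mul_le_mul_of_nonneg_right hamp (Real.exp_nonneg _)
  have hDX2 : HasMaj (BlockNorm.ofBlocks (unitTorusGeoS L (kk i) (Mn i) (Msz i)) (blockOf (L ^ kk i) (Mn i)))
      (BlockNorm.ofBlocks (unitTorusGeoS L (kk i) (Mn i) (Msz i)) (blockOf (L ^ kk i) (Mn i) ∘ underPtN L (kk i) (mm i) (Mn i)))
      (idef (pull (underPtN L (kk i) (mm i) (Mn i))) (pull (underPtN L (kk i) (mm i) (Mn i)))
        (dressedOp (kingGOp L aS 0 (kk i + mm i) (L ^ mm i * L ^ kk i) (Mn i)) (fun μ => kingDOp L aS 0 (kk i + mm i) (L ^ mm i * L ^ kk i) (Mn i) μ) (Vf i U))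
        (dressedOp (kingGOp L aS 0 (kk i) (L ^ kk i) (Mn i)) (fun μ => kingDOp L aS 0 (kk i) (L ^ kk i) (Mn i) μ) (Vc i (avg i U))))
      (fun y y' => mX * ((L : ℝ) ^ kk i) ^ (-(γ / 2)) * Real.exp (-(δ / 2 * (unitTorusGeoS L (kk i) (Mn i) (Msz i)).dist y y'))) := by
    refine hDX.mono fun y y' => ?_
    have hsub : δ - δ / 2 = δ / 2 := by ring
    rw [hsub]
    exact mul_le_mul_of_nonneg_right (mul_le_mul_of_nonneg_right ((bgConst_mono_a₀ hβ.le hcr hm₀.le hK hsa).trans_eq hmXdef.symm) hθ) (Real.exp_nonneg _)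
  -- part V §2: the size letters and the two-grid letter of the site perturbations (inner rate `δ∕2`, output rate `δ∕4`)
  have hPc := hasMaj_sitePert365 L (Mn i) (kk i) (Msz i) (blockOf (L ^ kk i) (Mn i)) hB0 hβ.le (by positivity : 0 ≤ ε * (Msz i * α₀)) (half_pos hδ) hXc2 hGc2 hEc2
  have hPf := hasMaj_sitePert365 L (Mn i) (kk i) (Msz i) (blockOf (L ^ kk i) (Mn i) ∘ underPtN L (kk i) (mm i) (Mn i)) hB0 hβ.le (by positivity : 0 ≤ ε * (Msz i * α₀)) (half_pos hδ)
    hXf2 hGf2 hEf2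
  have hPP := hasMaj_sitePert365365_sub L (Mn i) (kk i) (Msz i) (blockOf (L ^ kk i) (Mn i)) (underPtN L (kk i) (mm i) (Mn i)) hN hfibi hB0 hβ.le (mul_nonneg hmX0 hθ)
    (mul_nonneg hm₀.le hθ) (half_pos hδ) hXc2 hXf2 hDX2 hGc2 hGf2 hDG2
  have hlin : (B + β) * (ε * (Msz i * α₀)) * c2 ≤ ((B + β) * ε * c2 + 1) * (Msz i * α₀) := by
    have h1 : (B + β) * (ε * (Msz i * α₀)) * c2 = ((B + β) * ε * c2) * (Msz i * α₀) := by ring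
    rw [h1]
    exact mul_le_mul_of_nonneg_right (by linarith) hs0.le
  refine ⟨fun p p' => ?_, fun p p' => ?_, fun p p' => ?_⟩
  · refine (abs_siteEntries_le_of_hasMaj (L := L) (Mn i) (kk i) (Msz i) hPc p p').trans ?_
    rw [← hc2def]
    exact mul_le_mul_of_nonneg_right hlin (Real.exp_nonneg _)
  · refine (abs_siteEntries_le_of_hasMaj (L := L) (Mn i) (kk i) (Msz i) hPf p p').trans ?_
    rw [← hc2def]
    exact mul_le_mul_of_nonneg_right hlin (Real.exp_nonneg _)
  · rw [← Matrix.sub_apply, ← siteEntries_sub]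
    refine (abs_siteEntries_le_of_hasMaj (L := L) (Mn i) (kk i) (Msz i) hPP p p').trans ?_
    rw [← hc2def]
    have hE := Real.exp_nonneg (-(δ / 2 / 2 * tdist (Mn i) p p'))
    have h1 : 2 * c2 * (B * (mX * ((L : ℝ) ^ kk i) ^ (-(γ / 2))) + β * (m₀ * ((L : ℝ) ^ kk i) ^ (-(γ / 2)))) = (2 * c2 * (B * mX + β * m₀)) * ((L : ℝ) ^ kk i) ^ (-(γ / 2)) := by ring
    rw [h1]
    have h2 : (2 * c2 * (B * mX + β * m₀)) * ((L : ℝ) ^ kk i) ^ (-(γ / 2)) ≤ (2 * c2 * (B * mX + β * m₀) + 1) * ((L : ℝ) ^ kk i) ^ (-(γ / 2)) :=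
      mul_le_mul_of_nonneg_right (by linarith) hθ
    exact mul_le_mul_of_nonneg_right h2 hE

end Letters

/-! ## §3 ★★★ `NE2PlusSite` over the sized carriers from the species' sized letters alone -/

section SizedSocket

variable (Mn : I → Fin (d + 1) → ℕ) [hMn0 : ∀ i μ, NeZero (Mn i μ)] (kk mm : I → ℕ) (Msz : I → ℝ) (X : I → Type) [∀ i, Fintype (X i)]
  (blk : ∀ i, X i → Tor (Mn i)) (gf : I → B9.Geometry) (Bc Bf : I → B9.Backgrounds)
  (Vc : ∀ i, (Bc i).Cfg → ((Tor (fine (L ^ kk i) (Mn i)) × Option (Fin (d + 1)) → ℝ) →ₗ[ℝ] (Tor (fine (L ^ kk i) (Mn i)) → ℝ)))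
  (Vf : ∀ i, (Bf i).Cfg → ((Tor (fine (L ^ mm i * L ^ kk i) (Mn i)) × Option (Fin (d + 1)) → ℝ) →ₗ[ℝ] (Tor (fine (L ^ mm i * L ^ kk i) (Mn i)) → ℝ)))

/-- ★★★ **`NE2PlusSite` WITH THE BACKGROUND LIVE ON SIZE-LIVE CARRIERS FROM A SCALAR-SITE SPECIES' SIZED LETTERS ALONE** — §1 ∘ §2 on a family
`pi i = ⟨opGeo (unitTorusGeoS L (k i) (M i) (M_sz i)) (X i) (blk i), gf i, Bc i, Bf i, pair i⟩` (`gf.M = M_sz i` by the pairing's `M_eq`, `M_sz i ≥ 1`): the DRESSED site kernels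
`(Q′G′²Q′*_{L^mL^k} + P_f(U))⁻¹ − (Q′G′²Q′*_{L^k} + P_c(Ū))⁻¹` of THE massless scalar site propagator satisfy `NE2PlusSite d′ p c₃₅` — the printed smallness `M·α₀ ≤ a₀` live.
[cite: Balaban1985BackgroundPropagators, Thm 3.2 (3.48) p.398 + Thm 3.14 pp.426–427 (quantifier template), (3.63)–(3.67) pp.402–403 (mechanism); Balaban1984PropagatorsI, (1.45) p.26; King1986, Prop. 3.8 (3.71) p.664; CombesThomas1973, §II] -/
theorem ne2PlusSite_sSiteExOn_of_sizedSpeciesLetters (hLodd : Odd L) (hL2 : 2 ≤ L) {aS : ℝ} (haS : 0 < aS) (c35 : ℝ) (d' : ℕ) (p : ℝ) {γ : ℝ} (hγ0 : 0 < γ) (hγ1 : γ < 1)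
    {mT : I → ℕ} (hMnT : ∀ i μ, Mn i μ = 2 * L ^ mT i) (hk : ∀ i, 1 ≤ kk i) (hm : ∀ i, 1 ≤ mm i) (hMsz : ∀ i, 1 ≤ Msz i)
    (pair : ∀ i, EtaPairing (opGeo (unitTorusGeoS L (kk i) (Mn i) (Msz i)) (X i) (blk i)) (gf i) (Bc i) (Bf i))
    (hV : ∃ K a₁ : ℝ, 0 ≤ K ∧ 0 < a₁ ∧ ∀ (i : I) (α₀ : ℝ), 0 < α₀ → Msz i * α₀ ≤ a₁ → ∀ U : (Bf i).Cfg, (Bf i).Reg335 c35 α₀ U →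
      HasMaj (BlockNorm.ofBlocks (unitTorusGeoS L (kk i) (Mn i) (Msz i)) (blkPair (blockOf (L ^ kk i) (Mn i))))
        (BlockNorm.ofBlocks (unitTorusGeoS L (kk i) (Mn i) (Msz i)) (blockOf (L ^ kk i) (Mn i))) (Vc i ((pair i).avg U)) (diagK fun _ => K * (Msz i * α₀)) ∧
      HasMaj (BlockNorm.ofBlocks (unitTorusGeoS L (kk i) (Mn i) (Msz i)) (blkPair (blockOf (L ^ kk i) (Mn i) ∘ underPtN L (kk i) (mm i) (Mn i))))
        (BlockNorm.ofBlocks (unitTorusGeoS L (kk i) (Mn i) (Msz i)) (blockOf (L ^ kk i) (Mn i) ∘ underPtN L (kk i) (mm i) (Mn i))) (Vf i U) (diagK fun _ => K * (Msz i * α₀)) ∧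
      HasMaj (BlockNorm.ofBlocks (unitTorusGeoS L (kk i) (Mn i) (Msz i)) (blkPair (blockOf (L ^ kk i) (Mn i))))
        (BlockNorm.ofBlocks (unitTorusGeoS L (kk i) (Mn i) (Msz i)) (blockOf (L ^ kk i) (Mn i) ∘ underPtN L (kk i) (mm i) (Mn i)))
        (idef (pull (liftPair (underPtN L (kk i) (mm i) (Mn i)))) (pull (underPtN L (kk i) (mm i) (Mn i))) (Vf i U) (Vc i ((pair i).avg U)))
        (diagK fun _ => K * (Msz i * α₀) * ((L : ℝ) ^ kk i) ^ (-(γ / 2)))) :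
    NE2PlusSite d' p c35 (fun i => (⟨opGeo (unitTorusGeoS L (kk i) (Mn i) (Msz i)) (X i) (blk i), gf i, Bc i, Bf i, pair i⟩ : PairedInstance))
      (sSiteExOn Mn kk mm Msz X blk gf Bc Bf aS pair
        (fun i U => siteEntries (Mn i) (sitePert365 (Mn i) (blockOf (L ^ kk i) (Mn i) ∘ underPtN L (kk i) (mm i) (Mn i))
          (kingGOp L aS 0 (kk i + mm i) (L ^ mm i * L ^ kk i) (Mn i))
          (dressedOp (kingGOp L aS 0 (kk i + mm i) (L ^ mm i * L ^ kk i) (Mn i)) (fun μ => kingDOp L aS 0 (kk i + mm i) (L ^ mm i * L ^ kk i) (Mn i) μ) (Vf i U))))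
        (fun i V => siteEntries (Mn i) (sitePert365 (Mn i) (blockOf (L ^ kk i) (Mn i)) (kingGOp L aS 0 (kk i) (L ^ kk i) (Mn i))
          (dressedOp (kingGOp L aS 0 (kk i) (L ^ kk i) (Mn i)) (fun μ => kingDOp L aS 0 (kk i) (L ^ kk i) (Mn i) μ) (Vc i V))))) := by
  have hgM : ∀ i, (gf i).M = Msz i := fun i => (pair i).M_eq
  have hM : ∀ i, 1 ≤ (gf i).M := fun i => (hgM i).symm ▸ hMsz i
  obtain ⟨δP, ζ, τ, a₁, hδP, hζ, hτ, ha₁, HP⟩ :=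
    siteLetters_of_sizedSpeciesLetters (L := L) Mn kk mm Msz Bc Bf (fun i => (pair i).avg) Vc Vf hLodd hL2 haS c35 hγ0 hγ1 hMnT hk hm hMsz hV
  refine ne2PlusSite_sSiteExOn_of_sizedLetters Mn kk mm Msz X blk gf Bc Bf hLodd hL2 haS c35 d' p hMnT hk hM pair _ _ (half_pos hγ0)
    ⟨δP, ζ, τ, a₁, hδP, hζ, hτ, ha₁, fun i α₀ hα₀ hMα U hreg => ?_⟩
  rw [hgM i] at hMα ⊢
  exact HP i α₀ hα₀ hMα U hreg

end SizedSocket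

end Summit.QuantumFields.YangMills.BalabanUVNodes.N15.SiteLayerBg

end
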